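import Mathlib
import HarnessLib
import Summits.QuantumFields.YangMills.Theses.PencilRigidity
import Summits.QuantumFields.YangMills.Theorems.PencilRigidityCurvatureKernelBoundKernelPinning
import Summits.QuantumFields.YangMills.Theorems.PencilRigidityKernelTransferApprox
import Summits.QuantumFields.YangMills.Theorems.PencilRigidityKernelTransferPositivity

/-!
# `KernelTransfer` (stmt-QuantumFields-11688, route `PencilRigidity`) — the theorem

Closing file 3/3 for the support item `PencilRigidity.KernelTransfer`: the model-blind analysis
glue turning E3 + proper hypercubic invariance + reflection positivity for the eight planar
frames of a one-species family `𝔖` on `ℝ⁴` with two-point kernel `K(x₀ - x₁)` (real, continuous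
off `0`) into (i) `W(B₄)`-invariance of `K`, (ii) pointwise OS-positivity of `K` across `x₀ = 0`
and (iii) across `x₀ = x₁`.  Contents:

* determinants: `det = ±1` for every linear isometry of `ℝ⁴` (Cartan–Dieudonné,
  `LinearIsometryEquiv.reflections_generate_dim` + `Submodule.det_reflection`), `det(-1) = 1`,
  `det θ = -1` (`θ` is the mirror `e₀ᗮ`);
* signed permutations: `θ`, `-1` and `R ∘ θ` (for a signed permutation `R`) permute the axes up
  to sign;
* `exists_diagonal_frame` — the mirror exchanging `e₀` and `(e₀ - e₁)/√2` is a frame of the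
  hypothesis (`a = √2/2 = -b`), conjugates `θ` to the exchange of coordinates `0, 1`, and pulls the
  positive-time half-space back to `{x¹ < x⁰}`;
* `kernel_invariant_of_twoPoint_invariant` — invariance of `𝔖₂` on `⁰𝒮` under a linear isometry
  `R` forces `K ∘ R = K` (change of variables + pinning,
  `Theorems.CurvatureKernel.kernel_eq_zero_of_realTensor`);
* `kernelTransfer_proof` — the item.  (The E3 hypothesis of the item is not needed: evenness of
  `K` already follows from `-1 ∈ SO(4)`.)

Sources: Osterwalder–Schrader 1973 §§2–3; Glimm–Jaffe 1987 §6.1; Kravchuk–Qiao–Rychkov 2021 §2.2.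
[folklore]
-/

noncomputable section

open scoped BigOperators Topology SchwartzMap ComplexConjugate InnerProductSpace
open MeasureTheory Filter Set Module
open Literature.MathematicalPhysics.QuantumLattice Literature.MathematicalPhysics.AQFT

namespace Summit.QuantumFields.YangMills.Theorems.KernelTransfer

/-! ## Determinants of linear isometries of `ℝ⁴` -/

/-- The determinant of a reflection of `ℝ⁴` in the orthogonal complement of a line (possibly
degenerate) is `±1`. [folklore] -/
theorem det_reflection_eq_one_or (z : (EuclideanSpace ℝ (Fin 4))) :
    LinearMap.det ((ℝ ∙ z)ᗮ.reflection.toLinearEquiv : (EuclideanSpace ℝ (Fin 4)) →ₗ[ℝ] (EuclideanSpace ℝ (Fin 4))) = 1 ∨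
      LinearMap.det ((ℝ ∙ z)ᗮ.reflection.toLinearEquiv : (EuclideanSpace ℝ (Fin 4)) →ₗ[ℝ] (EuclideanSpace ℝ (Fin 4))) = -1 := by
  rw [Submodule.det_reflection]
  exact neg_one_pow_eq_or ℝ _

/-- **`det = ±1` on `O(4)`.** Every linear isometry of `ℝ⁴` has determinant `1` or `-1`
(Cartan–Dieudonné: it is a product of hyperplane reflections). [folklore] -/
theorem det_isometry_eq_one_or (R : (EuclideanSpace ℝ (Fin 4)) ≃ₗᵢ[ℝ] (EuclideanSpace ℝ (Fin 4))) :
    LinearMap.det (R.toLinearEquiv : (EuclideanSpace ℝ (Fin 4)) →ₗ[ℝ] (EuclideanSpace ℝ (Fin 4))) = 1 ∨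
      LinearMap.det (R.toLinearEquiv : (EuclideanSpace ℝ (Fin 4)) →ₗ[ℝ] (EuclideanSpace ℝ (Fin 4))) = -1 := by
  obtain ⟨l, -, hl⟩ := R.reflections_generate_dim
  rw [hl]
  clear hl
  induction l with
  | nil =>
    left
    rw [List.map_nil, List.prod_nil, LinearIsometryEquiv.one_def,
      show ((LinearIsometryEquiv.refl ℝ (EuclideanSpace ℝ (Fin 4))).toLinearEquiv : (EuclideanSpace ℝ (Fin 4)) →ₗ[ℝ] (EuclideanSpace ℝ (Fin 4))) = LinearMap.id from rfl,
      LinearMap.det_id]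
  | cons v l ih =>
    rw [List.map_cons, List.prod_cons, LinearIsometryEquiv.mul_def,
      LinearIsometryEquiv.toLinearEquiv_trans, LinearEquiv.coe_trans, LinearMap.det_comp]
    rcases det_reflection_eq_one_or v with h | h <;> rcases ih with h' | h' <;>
      rw [h, h'] <;> norm_num

/-- `det (-1) = 1` on `ℝ⁴`. [folklore] -/
theorem det_neg_eq_one :
    LinearMap.det ((LinearIsometryEquiv.neg ℝ : (EuclideanSpace ℝ (Fin 4)) ≃ₗᵢ[ℝ] (EuclideanSpace ℝ (Fin 4))).toLinearEquiv : (EuclideanSpace ℝ (Fin 4)) →ₗ[ℝ] (EuclideanSpace ℝ (Fin 4))) = 1 := by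
  have h : ((LinearIsometryEquiv.neg ℝ : (EuclideanSpace ℝ (Fin 4)) ≃ₗᵢ[ℝ] (EuclideanSpace ℝ (Fin 4))).toLinearEquiv : (EuclideanSpace ℝ (Fin 4)) →ₗ[ℝ] (EuclideanSpace ℝ (Fin 4))) =
      (-1 : ℝ) • LinearMap.id := by
    ext x
    simp [LinearIsometryEquiv.neg]
  rw [h, LinearMap.det_smul, LinearMap.det_id, finrank_euclideanSpace_fin]
  norm_num

/-! ## The time reflection as a hyperplane reflection -/

/-- `θ y = y - 2 y⁰ e₀`. [folklore] -/
theorem timeReflection_eq_sub (y : (EuclideanSpace ℝ (Fin 4))) :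
    timeReflection 4 y = y - (2 * y 0) • EuclideanSpace.single 0 1 := by
  ext i
  rw [timeReflection_apply]
  by_cases hi : i = 0
  · subst hi; simp; ring
  · simp [hi]

/-- `θ` is the reflection of `ℝ⁴` in the hyperplane `e₀ᗮ`. [folklore] -/
theorem timeReflection_eq_reflection :
    timeReflection 4 = (ℝ ∙ (EuclideanSpace.single 0 1 : (EuclideanSpace ℝ (Fin 4))))ᗮ.reflection := by
  refine LinearIsometryEquiv.ext fun y => ?_
  rw [timeReflection_eq_sub, Submodule.reflection_orthogonal_apply, Submodule.reflection_singleton_apply]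
  have h1 : ‖(EuclideanSpace.single 0 1 : (EuclideanSpace ℝ (Fin 4)))‖ = 1 := by simp
  have h2 : ⟪(EuclideanSpace.single 0 1 : (EuclideanSpace ℝ (Fin 4))), y⟫_ℝ = y 0 := by
    simp [EuclideanSpace.inner_single_left]
  rw [h1, h2]
  simp [two_smul]
  abel_nf
  module

/-- `det θ = -1`. [folklore] -/
theorem det_timeReflection :
    LinearMap.det ((timeReflection 4).toLinearEquiv : (EuclideanSpace ℝ (Fin 4)) →ₗ[ℝ] (EuclideanSpace ℝ (Fin 4))) = -1 := by
  have hz : (EuclideanSpace.single 0 1 : (EuclideanSpace ℝ (Fin 4))) ≠ 0 := by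
    intro h
    have := congrArg (fun v : (EuclideanSpace ℝ (Fin 4)) => v 0) h
    simp at this
  -- a hyperplane reflection has determinant `-1` (cf. `NPointIsotropy.Negative.det_reflection_hyperplane`)
  rw [timeReflection_eq_reflection, Submodule.det_reflection, Submodule.orthogonal_orthogonal,
    finrank_span_singleton hz, pow_one]

/-! ## Signed permutations -/

/-- `θ` permutes the axes up to sign. [folklore] -/
theorem timeReflection_single (i : Fin 4) : ∃ j : Fin 4,
    timeReflection 4 (EuclideanSpace.single i 1) = EuclideanSpace.single j 1 ∨
      timeReflection 4 (EuclideanSpace.single i 1) = -EuclideanSpace.single j 1 := by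
  refine ⟨i, ?_⟩
  by_cases hi : i = 0
  · subst hi
    right
    ext k
    rw [timeReflection_apply]
    by_cases hk : k = 0
    · subst hk; simp
    · simp [hk]
  · left
    ext k
    rw [timeReflection_apply]
    by_cases hk : k = 0
    · subst hk; simp [hi]
    · simp [hk]

/-- `-1` permutes the axes up to sign. [folklore] -/
theorem neg_single (i : Fin 4) : ∃ j : Fin 4,
    (LinearIsometryEquiv.neg ℝ : (EuclideanSpace ℝ (Fin 4)) ≃ₗᵢ[ℝ] (EuclideanSpace ℝ (Fin 4))) (EuclideanSpace.single i 1) = EuclideanSpace.single j 1 ∨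
      (LinearIsometryEquiv.neg ℝ : (EuclideanSpace ℝ (Fin 4)) ≃ₗᵢ[ℝ] (EuclideanSpace ℝ (Fin 4))) (EuclideanSpace.single i 1) = -EuclideanSpace.single j 1 :=
  ⟨i, Or.inr (by simp)⟩

/-- Signed permutations are stable under precomposition with `θ`. [folklore] -/
theorem theta_trans_single {R : (EuclideanSpace ℝ (Fin 4)) ≃ₗᵢ[ℝ] (EuclideanSpace ℝ (Fin 4))}
    (hR : ∀ i : Fin 4, ∃ j : Fin 4, R (EuclideanSpace.single i 1) = EuclideanSpace.single j 1 ∨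
      R (EuclideanSpace.single i 1) = -EuclideanSpace.single j 1) (i : Fin 4) :
    ∃ j : Fin 4, ((timeReflection 4).trans R) (EuclideanSpace.single i 1) = EuclideanSpace.single j 1 ∨
      ((timeReflection 4).trans R) (EuclideanSpace.single i 1) = -EuclideanSpace.single j 1 := by
  rw [LinearIsometryEquiv.trans_apply]
  obtain ⟨k, hk | hk⟩ := timeReflection_single i
  · rw [hk]; exact hR k
  · rw [hk, map_neg]
    obtain ⟨j, hj | hj⟩ := hR k
    · exact ⟨j, Or.inr (by rw [hj])⟩
    · exact ⟨j, Or.inl (by rw [hj, neg_neg])⟩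

/-! ## The diagonal frame -/

/-- **The diagonal frame.** There is a linear isometry `R` of `ℝ⁴` with
`R e₀ = (e₀ - e₁)/√2` (a frame admitted by the eight-frame hypothesis of `KernelTransfer`:
`a = √2/2`, `b = -√2/2`, `a² = b²`), conjugating the time reflection into the exchange of the
coordinates `0, 1` (`R θ R⁻¹ = swap₀₁`) and whose positive-time half-space pulls back to
`{x¹ < x⁰}`. We take for `R` the mirror exchanging `e₀` and `(e₀ - e₁)/√2`. [folklore] -/
theorem exists_diagonal_frame :
    ∃ (R : (EuclideanSpace ℝ (Fin 4)) ≃ₗᵢ[ℝ] (EuclideanSpace ℝ (Fin 4))) (a b : ℝ), a ^ 2 + b ^ 2 = 1 ∧ (a = 0 ∨ b = 0 ∨ a ^ 2 = b ^ 2) ∧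
      R (EuclideanSpace.single 0 1) = a • EuclideanSpace.single 0 1 + b • EuclideanSpace.single 1 1 ∧
      (∀ x : (EuclideanSpace ℝ (Fin 4)), R (timeReflection 4 (R.symm x)) =
        LinearIsometryEquiv.piLpCongrLeft 2 ℝ ℝ (Equiv.swap (0 : Fin 4) 1) x) ∧
      (∀ x : (EuclideanSpace ℝ (Fin 4)), x 1 < x 0 → 0 < (R.symm x) 0) := by
  set s : ℝ := Real.sqrt 2 / 2 with hs
  have hs2 : s * s = 1 / 2 := by
    rw [hs, div_mul_div_comm, Real.mul_self_sqrt (by norm_num : (0 : ℝ) ≤ 2)]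
    norm_num
  have hs0 : 0 < s := by positivity
  set e0 : (EuclideanSpace ℝ (Fin 4)) := EuclideanSpace.single 0 1 with he0
  set e1 : (EuclideanSpace ℝ (Fin 4)) := EuclideanSpace.single 1 1 with he1
  set u : (EuclideanSpace ℝ (Fin 4)) := s • e0 + (-s) • e1 with hu
  have hu_apply : ∀ i : Fin 4, u i = if i = 0 then s else if i = 1 then -s else 0 := by
    intro i
    fin_cases i <;> simp [hu, he0, he1]
  have hnorm : ‖e0‖ = ‖u‖ := by
    have h1 : ‖e0‖ = 1 := by simp [he0]
    have h2 : ‖u‖ ^ 2 = 1 := by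
      rw [EuclideanSpace.norm_sq_eq]
      simp [Fin.sum_univ_four, hu_apply]
      nlinarith [hs2]
    have h3 : ‖u‖ = 1 := by nlinarith [norm_nonneg u]
    rw [h1, h3]
  set R : (EuclideanSpace ℝ (Fin 4)) ≃ₗᵢ[ℝ] (EuclideanSpace ℝ (Fin 4)) := (ℝ ∙ (e0 - u))ᗮ.reflection with hR
  have hRe0 : R e0 = u := Submodule.reflection_sub hnorm
  have hRsymm : ∀ x, R.symm x = R x := fun x => by rw [hR, Submodule.reflection_symm]
  have hRR : ∀ x, R (R x) = x := fun x => Submodule.reflection_reflection _ _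
  have hux : ∀ x : (EuclideanSpace ℝ (Fin 4)), ⟪u, x⟫_ℝ = s * (x 0 - x 1) := by
    intro x
    simp only [hu, he0, he1, inner_add_left, real_inner_smul_left, EuclideanSpace.inner_single_left,
      map_one, one_mul]
    ring
  have hR0 : ∀ x : (EuclideanSpace ℝ (Fin 4)), (R x) 0 = s * (x 0 - x 1) := by
    intro x
    have h1 : (R x) 0 = ⟪e0, R x⟫_ℝ := by simp [he0, EuclideanSpace.inner_single_left]
    rw [h1, ← R.inner_map_map e0 (R x), hRR, hRe0, hux]
  refine ⟨R, s, -s, by nlinarith [hs2], Or.inr (Or.inr (by ring)), ?_, ?_, ?_⟩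
  · rw [hRe0, hu]
  · intro x
    rw [hRsymm, timeReflection_eq_sub, map_sub, map_smul, hRR, ← he0, hRe0, hR0]
    ext i
    simp only [LinearIsometryEquiv.piLpCongrLeft_apply, Equiv.piCongrLeft'_apply, Equiv.symm_swap,
      PiLp.sub_apply, PiLp.smul_apply, hu_apply]
    fin_cases i
    · simp [Equiv.swap_apply_left]; linear_combination (-2 * (x 0 - x 1)) * hs2
    · simp [Equiv.swap_apply_right]; linear_combination (2 * (x 0 - x 1)) * hs2
    · simp [Equiv.swap_apply_of_ne_of_ne]
    · simp [Equiv.swap_apply_of_ne_of_ne]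
  · intro x hx
    rw [hRsymm, hR0]
    nlinarith


/-! ## Proper hypercubic invariance of the kernel (pinning) -/

/-- **Invariance of the kernel under a symmetry of `𝔖₂`.** If `𝔖₂ = ∫ K(x₀ - x₁)·` on `⁰𝒮` with
`K` continuous off `0`, and `𝔖₂` is invariant on `⁰𝒮` under the pull-back by a linear isometry
`R`, then `K ∘ R = K` off `0` (change of variables + pinning of the continuous kernel
`K ∘ R - K` by bump tensors, `Theorems.CurvatureKernel.kernel_eq_zero_of_realTensor`). [folklore] -/
theorem kernel_invariant_of_twoPoint_invariant {S : SchwingerFamily (EuclideanSpace ℝ (Fin 4))} {K : (EuclideanSpace ℝ (Fin 4)) → ℝ}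
    (hK : ContinuousOn K {x : (EuclideanSpace ℝ (Fin 4)) | x ≠ 0})
    (hrep : ∀ F : 𝓢((Fin 2 → (EuclideanSpace ℝ (Fin 4))), ℂ), IsOffDiagonal F →
      Integrable (fun x : Fin 2 → (EuclideanSpace ℝ (Fin 4)) => (K (x 0 - x 1) : ℂ) * F x) ∧
        S 2 F = ∫ x : Fin 2 → (EuclideanSpace ℝ (Fin 4)), (K (x 0 - x 1) : ℂ) * F x)
    (R : (EuclideanSpace ℝ (Fin 4)) ≃ₗᵢ[ℝ] (EuclideanSpace ℝ (Fin 4)))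
    (hinv : ∀ F : 𝓢((Fin 2 → (EuclideanSpace ℝ (Fin 4))), ℂ), IsOffDiagonal F → S 2 (linActMulti R F) = S 2 F) :
    ∀ z : (EuclideanSpace ℝ (Fin 4)), K (R z) = K z := by
  have hW : ContinuousOn (fun z => K (R z) - K z) {x : (EuclideanSpace ℝ (Fin 4)) | x ≠ 0} := by
    refine ContinuousOn.sub ?_ hK
    refine hK.comp R.continuous.continuousOn fun z hz => ?_
    simp only [Set.mem_setOf_eq] at hz ⊢
    exact fun h => hz (R.map_eq_zero_iff.1 h)
  have hzero := Summit.QuantumFields.YangMills.Theorems.CurvatureKernel.kernel_eq_zero_of_realTensor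
    (fun z => K (R z) - K z) hW (fun f F _ hF _ _ => by
      obtain ⟨hint, hS⟩ := hrep F hF
      obtain ⟨hintR, hSR⟩ := rep_pullback hrep R F hF
      have hfun : (fun x : Fin 2 → (EuclideanSpace ℝ (Fin 4)) => (((fun z => K (R z) - K z) (x 0 - x 1) : ℝ) : ℂ) * F x) =
          fun x => (K (R (x 0 - x 1)) : ℂ) * F x - (K (x 0 - x 1) : ℂ) * F x := by
        funext x; push_cast; ring
      rw [hfun]
      refine ⟨hintR.sub hint, ?_⟩
      rw [integral_sub hintR hint, ← hSR, ← hS, hinv F hF, sub_self])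
  intro z
  by_cases hz : z = 0
  · subst hz; simp
  · exact sub_eq_zero.1 (hzero z hz)

/-! ## The theorem -/

/-- **`KernelTransfer`** (item stmt-QuantumFields-11688 of route `PencilRigidity`): for a
one-species family `𝔖` on `ℝ⁴` whose two-point function on `⁰𝒮` is `∫ K(x₀ - x₁)·` with a real
kernel `K` continuous off `0`, E3-symmetric, invariant on `⁰𝒮` under the proper signed
permutations and reflection positive in pull-back form for the eight frames
`R e₀ = a e₀ + b e₁` (`a² + b² = 1`, `a = 0 ∨ b = 0 ∨ a² = b²`):
(i) `K ∘ R = K` for EVERY signed permutation `R` (proper ones by pinning; `θ` from the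
hermiticity of the E2 form + evenness via `-1 ∈ SO(4)`; an improper `R` is `(R ∘ θ) ∘ θ`);
(ii) `∑ cᵢcⱼ K(θxᵢ - xⱼ) ≥ 0` for `xᵢ⁰ > 0` (E2 on one-point bumps, continuity of `K`);
(iii) the same across `x⁰ = x¹`, from (ii) for the family pulled back by the mirror exchanging
`e₀` and `(e₀ - e₁)/√2`, whose kernel is `K ∘ R` and which conjugates `θ` to the swap of the
coordinates `0, 1`. [folklore] -/
theorem kernelTransfer_proof : Summit.QuantumFields.YangMills.Theses.PencilRigidity.KernelTransfer := by
  intro S₁ K hK h2 _hE3 hHyp hRP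
  -- E2 of the family itself (the frame `R = 1`)
  have hRP1 : S₁.toLabelled.IsReflectionPositive := by
    have h := hRP (LinearIsometryEquiv.refl ℝ (EuclideanSpace ℝ (Fin 4))) 1 0 (by norm_num) (Or.inr (Or.inl rfl)) (by simp)
    have hid : (fun n => (S₁ n).comp (linActMulti (LinearIsometryEquiv.refl ℝ (EuclideanSpace ℝ (Fin 4))))) = S₁ := by
      funext n
      ext F
      simp only [ContinuousLinearMap.coe_comp, Function.comp_apply]
      congr 1
    rw [hid] at h
    exact h
  -- (ii) pointwise positivity across `x₀ = 0`
  have hpos : ∀ (m : ℕ) (x : Fin m → (EuclideanSpace ℝ (Fin 4))) (c : Fin m → ℝ), (∀ i, 0 < x i 0) →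
      0 ≤ ∑ i, ∑ j, c i * c j * K (timeReflection 4 (x i) - x j) :=
    kernel_pos_of_isReflectionPositive hK h2 hRP1
  -- proper hypercubic invariance of `K`
  have hprop : ∀ R : (EuclideanSpace ℝ (Fin 4)) ≃ₗᵢ[ℝ] (EuclideanSpace ℝ (Fin 4)), LinearMap.det (R.toLinearEquiv : (EuclideanSpace ℝ (Fin 4)) →ₗ[ℝ] (EuclideanSpace ℝ (Fin 4))) = 1 →
      (∀ i : Fin 4, ∃ j : Fin 4, R (EuclideanSpace.single i 1) = EuclideanSpace.single j 1 ∨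
        R (EuclideanSpace.single i 1) = -EuclideanSpace.single j 1) →
      ∀ z : (EuclideanSpace ℝ (Fin 4)), K (R z) = K z := fun R hdet hsp =>
    kernel_invariant_of_twoPoint_invariant hK h2 R fun F hF => hHyp R hdet hsp 2 F hF
  -- evenness (`-1` is a proper signed permutation of `ℝ⁴`)
  have heven : ∀ z : (EuclideanSpace ℝ (Fin 4)), K (-z) = K z := fun z => by
    have h := hprop (LinearIsometryEquiv.neg ℝ) det_neg_eq_one neg_single z
    simpa using h
  -- `θ`-invariance
  have hherm := kernel_theta_symm_of_isReflectionPositive hK h2 hRP1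
  have hθneg : ∀ z : (EuclideanSpace ℝ (Fin 4)), z 0 < 0 → K z = K (timeReflection 4 z) := by
    intro z hz
    have ha : 0 < (timeReflection 4 ((1 / 2 : ℝ) • z)) 0 := by
      rw [timeReflection_apply, if_pos rfl, PiLp.smul_apply, smul_eq_mul]; linarith
    have hb : 0 < ((-(1 / 2 : ℝ)) • z) 0 := by
      rw [PiLp.smul_apply, smul_eq_mul]; linarith
    have h := hherm _ _ ha hb
    have e1 : timeReflection 4 (timeReflection 4 ((1 / 2 : ℝ) • z)) - (-(1 / 2 : ℝ)) • z = z := by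
      rw [timeReflection_timeReflection]; module
    have e2 : timeReflection 4 ((-(1 / 2 : ℝ)) • z) - timeReflection 4 ((1 / 2 : ℝ) • z) =
        -timeReflection 4 z := by
      rw [map_smul, map_smul]; module
    rw [e1, e2, heven] at h
    exact h
  have hθ : ∀ z : (EuclideanSpace ℝ (Fin 4)), K (timeReflection 4 z) = K z := by
    intro z
    rcases lt_trichotomy (z 0) 0 with hlt | heq | hgt
    · exact (hθneg z hlt).symm
    · congr 1
      ext i
      rw [timeReflection_apply]
      split_ifs with hi
      · subst hi; rw [heq, neg_zero]
      · rfl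
    · have hlt : (timeReflection 4 z) 0 < 0 := by
        rw [timeReflection_apply, if_pos rfl]; linarith
      have h := hθneg _ hlt
      rw [timeReflection_timeReflection] at h
      exact h
  -- (i) invariance under every signed permutation
  have hinv : ∀ R : (EuclideanSpace ℝ (Fin 4)) ≃ₗᵢ[ℝ] (EuclideanSpace ℝ (Fin 4)),
      (∀ i : Fin 4, ∃ j : Fin 4, R (EuclideanSpace.single i 1) = EuclideanSpace.single j 1 ∨
        R (EuclideanSpace.single i 1) = -EuclideanSpace.single j 1) →
      ∀ x : (EuclideanSpace ℝ (Fin 4)), K (R x) = K x := by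
    intro R hsp x
    rcases det_isometry_eq_one_or R with hdet | hdet
    · exact hprop R hdet hsp x
    · have hdet' : LinearMap.det (((timeReflection 4).trans R).toLinearEquiv : (EuclideanSpace ℝ (Fin 4)) →ₗ[ℝ] (EuclideanSpace ℝ (Fin 4))) = 1 := by
        rw [LinearIsometryEquiv.toLinearEquiv_trans, LinearEquiv.coe_trans, LinearMap.det_comp, hdet,
          det_timeReflection]
        norm_num
      have h := hprop _ hdet' (theta_trans_single hsp) (timeReflection 4 x)
      rw [LinearIsometryEquiv.trans_apply, timeReflection_timeReflection] at h
      rw [h, hθ]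
  refine ⟨hinv, hpos, ?_⟩
  -- (iii) the diagonal mirror, from (ii) for the pulled-back family
  obtain ⟨Rd, a, b, hab, habc, hRe0, hswap, hpos0⟩ := exists_diagonal_frame
  have hRPd := hRP Rd a b hab habc hRe0
  have hKd : ContinuousOn (fun z : (EuclideanSpace ℝ (Fin 4)) => K (Rd z)) {x : (EuclideanSpace ℝ (Fin 4)) | x ≠ 0} := by
    refine hK.comp Rd.continuous.continuousOn fun z hz => ?_
    simp only [Set.mem_setOf_eq] at hz ⊢
    exact fun h => hz (Rd.map_eq_zero_iff.1 h)
  have hrepd : ∀ F : 𝓢((Fin 2 → (EuclideanSpace ℝ (Fin 4))), ℂ), IsOffDiagonal F →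
      Integrable (fun x : Fin 2 → (EuclideanSpace ℝ (Fin 4)) => ((fun z : (EuclideanSpace ℝ (Fin 4)) => K (Rd z)) (x 0 - x 1) : ℂ) * F x) ∧
        (fun n => (S₁ n).comp (linActMulti Rd)) 2 F =
          ∫ x : Fin 2 → (EuclideanSpace ℝ (Fin 4)), ((fun z : (EuclideanSpace ℝ (Fin 4)) => K (Rd z)) (x 0 - x 1) : ℂ) * F x :=
    fun F hF => rep_pullback h2 Rd F hF
  have hposd := kernel_pos_of_isReflectionPositive (S := fun n => (S₁ n).comp (linActMulti Rd))
    (K := fun z : (EuclideanSpace ℝ (Fin 4)) => K (Rd z)) hKd hrepd hRPd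
  intro m x c hx
  have h := hposd m (fun i => Rd.symm (x i)) c (fun i => hpos0 (x i) (hx i))
  have hpt : ∀ i j, Rd (timeReflection 4 (Rd.symm (x i)) - Rd.symm (x j)) =
      LinearIsometryEquiv.piLpCongrLeft 2 ℝ ℝ (Equiv.swap (0 : Fin 4) 1) (x i) - x j := by
    intro i j
    rw [map_sub, hswap, LinearIsometryEquiv.apply_symm_apply]
  simp only [hpt] at h
  exact h

end Summit.QuantumFields.YangMills.Theorems.KernelTransfer

end
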